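import Summits.HodgeConjecture.HodgeConjecture.Theorems.GenericDivisibilityHodgeClassesGenericallyDivisibleFinite
import Literature.AlgebraicGeometry.HodgeTheory.SmallChowGroupsHodgeConjectureHolds

/-!
# Route GenericDivisibility — crux `HodgeClassesGenericallyDivisible` (C1, item stmt-HodgeConjecture-18466):
# the known sector at `p ≥ 2` — `2p`-folds with small Chow groups (Laterveer 1998 / Vial 2013)

The crux C1 ("integral middle Hodge classes are divisible by every `m` on a non-empty Zariski open")
is an OPEN PROBLEM for `p ≥ 2` (Hodge-conjecture strength; see the companion files
`…HodgeClassesGenericallyDivisible{,Finite,Unramified,SketchReduction}`).  Its first open case is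
`p = 2`: `Hdg⁴(X, ℤ)` of a smooth projective fourfold.  This file records, sorry-free, the SECTOR of that
case (and of every `p ≥ 1`) which the tree already decides, granted the same two printed theorems as
the `p = 1` record `hodgeClassesGenericallyDivisible_one_of_facts`:

* the Hodge conjecture for a smooth projective complex `2p`-fold whose Chow groups `CH_i(X_L) ⊗ ℚ`,
  `i ≤ p - 2`, have rank `≤ 1` over every algebraically closed `L ⊇ ℂ` is a THEOREM of the tree
  (`Vial2013_hodgeConjectureFor_of_chowGroups_rank_le_one_holds`: Laterveer 1998 / Vial 2013
  Thm. 7.1 (i), discharged over the complex-orientation Gysin formalism, Hironaka, Lefschetz `(1,1)` and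
  hard Lefschetz); for `p = 2` the hypothesis is `CH₀(X_L) ⊗ ℚ = ℚ` (e.g. rationally connected
  fourfolds);
* so the pointwise form of "HC ⇒ C1" (`genericDivisibility_exists_restrict_eq_zero_of_hodgeConjectureFor`)
  gives: every integral class `z ∈ H²ᵖ(X(ℂ); ℤ)` with `(p,p)` complexification on such an `X` restricts
  to ZERO on the complex points of a non-empty Zariski open — granted `TorsionDiesGenerically`
  (Colliot-Thélène–Voisin 2012 Thm. 3.1, item stmt-HodgeConjecture-18850) and finite generation of
  `H_{2p-1}((X ∖ Z)(ℂ); ℤ)` (Dimca 1992 Ch. 1 Cor. (6.10)) — hence is divisible by every `m` there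
  (`y = 0`): C1 holds on this sector with trust base exactly the two registered named facts
  (`…_of_facts`), and for fourfolds with `CH₀` of rank `≤ 1` (`…_fourfold_of_facts`).

Nothing here claims the crux; the general `p ≥ 2` case is untouched.

References: Ch. Vial, *Algebraic cycles and fibrations*, Doc. Math. 18 (2013), Thm. 7.1 (i) [Vial2013];
R. Laterveer, J. Math. Kyoto Univ. 38 (1998) [Laterveer1998]; J.-L. Colliot-Thélène, C. Voisin, Duke
Math. J. 161 (2012), Thm. 3.1, Prop. 3.3 (i) [ColliotTheleneVoisin2012]; A. Dimca (1992), Ch. 1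
Cor. (6.10) [Dimca1992].
-/

-- mandated namespace `Summit.HodgeConjecture.HodgeConjecture.Theorems` (Problem = Summit) trips
-- `linter.dupNamespace`; the lakefile disables it tree-wide, restated for stand-alone elaboration.
set_option linter.dupNamespace false

noncomputable section

namespace Summit.HodgeConjecture.HodgeConjecture.Theorems

open CategoryTheory AlgebraicGeometry
open Literature.AlgebraicGeometry.Motives Literature.AlgebraicGeometry.HodgeTheory
  Literature.AlgebraicTopology.SingularHomology
open Summit.HodgeConjecture.HodgeConjecture.Theses.GenericDivisibility

/-- **Small Chow groups ⇒ integral middle Hodge classes die on a non-empty Zariski open** (granted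
`TorsionDiesGenerically` and finite generation of `H_{2p-1}` of the proper Zariski opens).  For `p ≥ 1`
and `X` smooth projective of dimension `2p` whose Chow groups `CH_i(X_L)`, `i ≤ (2p-4)/2 = p-2`, have
rank `≤ 1` over every algebraically closed `L ⊇ ℂ`, the Hodge conjecture holds for `X`
(`Vial2013_hodgeConjectureFor_of_chowGroups_rank_le_one_holds`, a theorem of the tree), so the pointwise
form `genericDivisibility_exists_restrict_eq_zero_of_hodgeConjectureFor` applies: every
`z ∈ H²ᵖ(X(ℂ); ℤ)` with `(p,p)` complexification restricts to `0` on `(X ∖ Z)(ℂ)` for some proper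
Zariski-closed `Z`. [cite: Vial2013, Thm 7.1 (i)] [cite: ColliotTheleneVoisin2012, Thm 3.1 and Prop 3.3 (i)] -/
theorem genericDivisibility_exists_restrict_eq_zero_of_chowGroups_rank_le_one
    {p : ℕ} {X : SchemeOver ℂ} (hp : 1 ≤ p) (hX : IsSmoothProjective (2 * p) X)
    (hCH : ∀ (L : Type) [Field L] [IsAlgClosed L] [Algebra ℂ L] (i : ℕ), i ≤ (2 * p - 4) / 2 →
      ∀ a b : ChowGroup ((baseChange ℂ L).obj X).left i, ∃ m n : ℤ, (m ≠ 0 ∨ n ≠ 0) ∧ m • a = n • b)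
    (hT : TorsionDiesGenerically)
    (hfin : ∀ Z : Set X.left, IsClosed Z → Z ≠ Set.univ →
      Module.Finite ℤ (singularHomology ℤ ℤ (complexPointsCompl X Z) (2 * p - 1)))
    (z : singularCohomology ℤ ℤ (ComplexPoints X) (2 * p))
    (hz : IsOfHodgeType (2 * p) X (2 * p) p p
      (singularCohomology.ringChange (Int.castRingHom ℂ) (ComplexPoints X) (2 * p) z)) :
    ∃ Z : Set X.left, IsClosed Z ∧ Z ≠ Set.univ ∧
      singularCohomology.map ℤ ℤ
        (⟨Subtype.val, continuous_subtype_val⟩ : C(complexPointsCompl X Z, ComplexPoints X))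
        (2 * p) z = 0 :=
  genericDivisibility_exists_restrict_eq_zero_of_hodgeConjectureFor hp hX
    (Vial2013_hodgeConjectureFor_of_chowGroups_rank_le_one_holds hX hCH) hT hfin z hz

/-- **C1 on the small-Chow-group sector, trust base = the two registered named facts.**  Granted
`Dimca1992_finite_singularHomology_complexPointsCompl` (Dimca 1992 Ch. 1 Cor. (6.10)) and
`ColliotTheleneVoisin2012_torsionDiesGenerically` (Colliot-Thélène–Voisin 2012 Thm. 3.1), the instance of
the crux `HodgeClassesGenericallyDivisible` at every smooth projective `2p`-fold (`p ≥ 1`) with Chow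
groups `CH_i(X_L)`, `i ≤ p - 2`, of rank `≤ 1` holds: for every `m ≥ 1` an integral class with `(p,p)`
complexification is divisible by `m` (indeed zero) on the complex points of a non-empty Zariski open.
[cite: Vial2013, Thm 7.1 (i)] [cite: ColliotTheleneVoisin2012, Thm 3.1] [cite: Dimca1992, Ch. 1 Cor. (6.10)] -/
theorem hodgeClassesGenericallyDivisible_of_chowGroups_rank_le_one_of_facts
    (hfin : Dimca1992_finite_singularHomology_complexPointsCompl)
    (hT : ColliotTheleneVoisin2012_torsionDiesGenerically)
    ⦃p : ℕ⦄ ⦃X : SchemeOver ℂ⦄ (hp : 1 ≤ p) (hX : IsSmoothProjective (2 * p) X)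
    (hCH : ∀ (L : Type) [Field L] [IsAlgClosed L] [Algebra ℂ L] (i : ℕ), i ≤ (2 * p - 4) / 2 →
      ∀ a b : ChowGroup ((baseChange ℂ L).obj X).left i, ∃ m n : ℤ, (m ≠ 0 ∨ n ≠ 0) ∧ m • a = n • b)
    (z : singularCohomology ℤ ℤ (ComplexPoints X) (2 * p))
    (hz : IsOfHodgeType (2 * p) X (2 * p) p p
      (singularCohomology.ringChange (Int.castRingHom ℂ) (ComplexPoints X) (2 * p) z))
    (m : ℕ) (_hm : 1 ≤ m) :
    ∃ Z : Set X.left, IsClosed Z ∧ Z ≠ Set.univ ∧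
      ∃ y : singularCohomology ℤ ℤ (complexPointsCompl X Z) (2 * p),
        m • y = singularCohomology.map ℤ ℤ
          (⟨Subtype.val, continuous_subtype_val⟩ : C(complexPointsCompl X Z, ComplexPoints X))
          (2 * p) z := by
  obtain ⟨Z, hZ, hZne, h0⟩ := genericDivisibility_exists_restrict_eq_zero_of_chowGroups_rank_le_one hp
    hX hCH (genericDivisibility_torsionDiesGenerically_of_colliotTheleneVoisin hT)
    (fun Z hZ _ ↦ hfin hX Z hZ (2 * p - 1)) z hz
  exact ⟨Z, hZ, hZne, 0, by rw [smul_zero]; exact h0.symm⟩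

/-- **The first open case `p = 2` on its known sector: fourfolds with `CH₀` of rank `≤ 1`.**  Granted the
two printed theorems (Dimca 1992 Cor. (6.10), Colliot-Thélène–Voisin 2012 Thm. 3.1), on a smooth
projective complex fourfold `X` with `CH₀(X_L) ⊗ ℚ` of dimension `≤ 1` over every algebraically closed
`L ⊇ ℂ` (e.g. a rationally connected fourfold), every integral class in `H⁴(X(ℂ); ℤ)` with `(2,2)`
complexification is divisible by every `m ≥ 1` on the complex points of a non-empty Zariski open — the
instance of C1 the crux's first open case asks about, on the CH₀-trivial sector (Colliot-Thélène–Voisin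
2012 Prop. 3.3 (i) territory).  The Chow hypothesis of the general theorem ranges over `i ≤ 0` only.
[cite: Vial2013, Thm 7.1 (i)] [cite: ColliotTheleneVoisin2012, Thm 3.1 and Prop 3.3 (i)]
[cite: Dimca1992, Ch. 1 Cor. (6.10)] -/
theorem hodgeClassesGenericallyDivisible_fourfold_of_chowZero_rank_le_one_of_facts
    (hfin : Dimca1992_finite_singularHomology_complexPointsCompl)
    (hT : ColliotTheleneVoisin2012_torsionDiesGenerically)
    ⦃X : SchemeOver ℂ⦄ (hX : IsSmoothProjective (2 * 2) X)
    (hCH₀ : ∀ (L : Type) [Field L] [IsAlgClosed L] [Algebra ℂ L],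
      ∀ a b : ChowGroup ((baseChange ℂ L).obj X).left 0, ∃ m n : ℤ, (m ≠ 0 ∨ n ≠ 0) ∧ m • a = n • b)
    (z : singularCohomology ℤ ℤ (ComplexPoints X) (2 * 2))
    (hz : IsOfHodgeType (2 * 2) X (2 * 2) 2 2
      (singularCohomology.ringChange (Int.castRingHom ℂ) (ComplexPoints X) (2 * 2) z))
    (m : ℕ) (hm : 1 ≤ m) :
    ∃ Z : Set X.left, IsClosed Z ∧ Z ≠ Set.univ ∧
      ∃ y : singularCohomology ℤ ℤ (complexPointsCompl X Z) (2 * 2),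
        m • y = singularCohomology.map ℤ ℤ
          (⟨Subtype.val, continuous_subtype_val⟩ : C(complexPointsCompl X Z, ComplexPoints X))
          (2 * 2) z := by
  refine hodgeClassesGenericallyDivisible_of_chowGroups_rank_le_one_of_facts hfin hT (p := 2) (by norm_num)
    hX (fun L _ _ _ i hi a b ↦ ?_) z hz m hm
  obtain rfl : i = 0 := Nat.le_zero.1 (by simpa using hi)
  exact hCH₀ L a b

/-- **Registered form (item stmt-HodgeConjecture-18466, sub-goal `hodgeClassesGenericallyDivisible_smallChowSector`):
the small-Chow-group sector of C1 in one closed formula** — for `p ≥ 1` and `X` smooth projective of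
dimension `2p` with `CH_i(X_L)` of rank `≤ 1` for `i ≤ p - 2` and all algebraically closed `L ⊇ ℂ`,
granted `TorsionDiesGenerically` and finite generation of `H_{2p-1}((X ∖ Z)(ℂ); ℤ)` for the proper closed
`Z`, every integral class with `(p,p)` complexification restricts to zero on the complex points of a
non-empty Zariski open (`genericDivisibility_exists_restrict_eq_zero_of_chowGroups_rank_le_one` with all
hypotheses after the colon, so that the statement is the registered signature verbatim).
[cite: Vial2013, Thm 7.1 (i)] [cite: ColliotTheleneVoisin2012, Thm 3.1 and Prop 3.3 (i)] -/
theorem hodgeClassesGenericallyDivisible_smallChowSector :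
    ∀ ⦃p : ℕ⦄ ⦃X : SchemeOver ℂ⦄, 1 ≤ p → IsSmoothProjective (2 * p) X →
      (∀ (L : Type) [Field L] [IsAlgClosed L] [Algebra ℂ L] (i : ℕ), i ≤ (2 * p - 4) / 2 →
        ∀ a b : ChowGroup ((baseChange ℂ L).obj X).left i, ∃ m n : ℤ, (m ≠ 0 ∨ n ≠ 0) ∧ m • a = n • b) →
      TorsionDiesGenerically →
      (∀ Z : Set X.left, IsClosed Z → Z ≠ Set.univ →
        Module.Finite ℤ (singularHomology ℤ ℤ (complexPointsCompl X Z) (2 * p - 1))) →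
      ∀ z : singularCohomology ℤ ℤ (ComplexPoints X) (2 * p),
        IsOfHodgeType (2 * p) X (2 * p) p p
          (singularCohomology.ringChange (Int.castRingHom ℂ) (ComplexPoints X) (2 * p) z) →
        ∃ Z : Set X.left, IsClosed Z ∧ Z ≠ Set.univ ∧
          singularCohomology.map ℤ ℤ
            (⟨Subtype.val, continuous_subtype_val⟩ : C(complexPointsCompl X Z, ComplexPoints X))
            (2 * p) z = 0 :=
  fun _p _X hp hX hCH hT hfin z hz ↦
    genericDivisibility_exists_restrict_eq_zero_of_chowGroups_rank_le_one hp hX hCH hT hfin z hz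

end Summit.HodgeConjecture.HodgeConjecture.Theorems

end
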